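import Mathlib
import Literature.NumberTheory.Sieve.FriedlanderIwaniecPrimesCharacterDetection
import HarnessLib

/-!
# Dilation-invariant kernels on a finite field: the form is bounded by the largest character sum — PROVED

Topic `NumberTheory/GaussSums` (harmonic analysis on the multiplicative group of a finite field).
Let `F` be a finite field and `K : F → F → ℂ` a kernel invariant under dilations,
`K(is, it) = K(s, t)` for `i ≠ 0`.  On `Fˣ` it is the multiplicative convolution by
`f(λ) = K(1, λ)` (`K(s, t) = f(t/s)`), which the characters `χ` of `Fˣ` diagonalise with
eigenvalues `Λ(χ) = ∑_λ f(λ) χ(λ)` (Lovász 1975 / Babai 1979 for general transitive groups; for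
the affine group of `𝔽_p` this is the multiplicative half of Kunisky–Yu 2022, Proposition 4.19).
We prove the resulting bound as an inequality of finite sums, with no spectral theory:

* `dilationKernel_eq_sum_mulChar`: for `s, t ≠ 0`,
  `K(s, t) = (#Fˣ)⁻¹ ∑_χ Λ(χ) χ(s) conj χ(t)` (orthogonality of characters, from the tree's
  `Literature.NumberTheory.Sieve.FriedlanderIwaniecPrimes.indicator_eq_sum_mulChar`);
* `norm_dilationKernel_form_le`: if `|Λ(χ)| ≤ B` for every multiplicative character `χ`, then
  `|∑_{s,t} x_s conj(x_t) K(s,t)| ≤ B ∑_s |x_s|²` for every `x : F → ℂ` with `x_0 = 0`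
  (Plancherel `∑_χ |∑_s x_s χ(s)|² = #Fˣ ∑_s |x_s|²`).

Used for the zero-frequency block of the Kunisky–Yu matrix `T^{4,4,1}`
(`Literature/Combinatorics/SimpleGraph/PaleyT441M0.lean`).

## References

* L. Lovász, *Spectra of graphs with transitive groups*, Period. Math. Hungar. 6 (1975) 191–195.
* D. Kunisky, X. Yu, arXiv:2211.02713 (2022), Proposition 4.19.  [KuniskyYu2022]
-/

noncomputable section

open Finset
open Literature.NumberTheory.Sieve.FriedlanderIwaniecPrimes

namespace Literature.NumberTheory.GaussSums

section Dilation

variable {F : Type*} [Field F] [Fintype F] [DecidableEq F]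

/-- For a unit `t` of a finite field, `conj χ(t) = χ(t)⁻¹`. [folklore] -/
theorem conj_mulChar_apply_of_ne_zero (χ : MulChar F ℂ) {t : F} (ht : t ≠ 0) :
    (starRingEnd ℂ) (χ t) = (χ t)⁻¹ := by
  have hu : IsUnit t := isUnit_iff_ne_zero.mpr ht
  obtain ⟨u, rfl⟩ := hu
  rw [inv_mulChar_apply_units]

/-- **Spectral expansion of a dilation-invariant kernel** (the multiplicative characters
diagonalise it): for `s, t ≠ 0`,
`K(s,t) = (#Fˣ)⁻¹ ∑_χ (∑_λ K(1,λ) χ(λ)) χ(s) conj χ(t)`.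
[cite: KuniskyYu2022, Proposition 4.19] -/
theorem dilationKernel_eq_sum_mulChar (K : F → F → ℂ)
    (hK : ∀ i : F, i ≠ 0 → ∀ s t : F, K (i * s) (i * t) = K s t) {s t : F} (hs : s ≠ 0)
    (ht : t ≠ 0) :
    K s t = (Fintype.card Fˣ : ℂ)⁻¹ *
      ∑ χ : MulChar F ℂ, (∑ l : F, K 1 l * χ l) * (χ s * (starRingEnd ℂ) (χ t)) := by
  -- `K(s,t) = K(1, s⁻¹ t) = ∑_l K(1,l) [t = l s]`
  have h1 : K s t = K 1 (s⁻¹ * t) := by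
    have := hK s⁻¹ (inv_ne_zero hs) s t
    rw [inv_mul_cancel₀ hs] at this
    exact this.symm
  have h2 : K 1 (s⁻¹ * t) = ∑ l : F, K 1 l * (if t = l * s then (1 : ℂ) else 0) := by
    have hiff : ∀ l : F, t = l * s ↔ l = s⁻¹ * t := by
      intro l
      constructor
      · intro h
        rw [h, mul_comm l s, ← mul_assoc, inv_mul_cancel₀ hs, one_mul]
      · intro h
        rw [h, mul_comm, ← mul_assoc, mul_inv_cancel₀ hs, one_mul]
    simp_rw [hiff, mul_ite, mul_one, mul_zero]
    rw [Finset.sum_ite_eq' Finset.univ (s⁻¹ * t)]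
    simp
  rw [h1, h2]
  have ht' : IsUnit t := isUnit_iff_ne_zero.mpr ht
  simp_rw [indicator_eq_sum_mulChar ht']
  rw [Finset.mul_sum]
  simp_rw [Finset.mul_sum]
  rw [Finset.sum_comm]
  refine Finset.sum_congr rfl fun χ _ => ?_
  rw [Finset.sum_mul, Finset.mul_sum]
  refine Finset.sum_congr rfl fun l _ => ?_
  rw [conj_mulChar_apply_of_ne_zero χ ht]
  ring

/-- **Plancherel** for the multiplicative characters of a finite field, for vectors vanishing at
`0`: `∑_χ |∑_s x_s χ(s)|² = #Fˣ ∑_s |x_s|²`. [folklore] -/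
theorem sum_norm_sq_mulCharSum_eq (x : F → ℂ) (hx : x 0 = 0) :
    ∑ χ : MulChar F ℂ, ‖∑ s : F, x s * χ s‖ ^ 2 = (Fintype.card Fˣ : ℝ) * ∑ s : F, ‖x s‖ ^ 2 := by
  have hn : (Fintype.card Fˣ : ℝ) ≠ 0 := by exact_mod_cast Fintype.card_ne_zero
  -- restrict the sums to `s ≠ 0`
  set H : Finset F := Finset.univ.filter fun s => s ≠ 0 with hH
  have hsum : ∀ (G : F → ℂ), (∀ s, s = 0 → G s = 0) → ∑ s : F, G s = ∑ s ∈ H, G s := by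
    intro G hG
    rw [hH, Finset.sum_filter]
    refine Finset.sum_congr rfl fun s _ => ?_
    by_cases hs : s = 0
    · rw [if_neg (by simpa using hs), hG s hs]
    · rw [if_pos hs]
  have hsumR : ∀ (G : F → ℝ), (∀ s, s = 0 → G s = 0) → ∑ s : F, G s = ∑ s ∈ H, G s := by
    intro G hG
    rw [hH, Finset.sum_filter]
    refine Finset.sum_congr rfl fun s _ => ?_
    by_cases hs : s = 0
    · rw [if_neg (by simpa using hs), hG s hs]
    · rw [if_pos hs]
  have h1 : ∀ χ : MulChar F ℂ, ∑ s : F, x s * χ s = ∑ s ∈ H, x s * χ (id s) := by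
    intro χ
    exact hsum _ fun s hs => by rw [hs, hx, zero_mul]
  simp_rw [h1]
  have hunit : ∀ i ∈ H, IsUnit (id i : F) := by
    intro i hi
    rw [hH, Finset.mem_filter] at hi
    exact isUnit_iff_ne_zero.mpr hi.2
  have key := sum_norm_sq_charSum_eq (M := F) H id hunit (Set.injOn_id _) x
  rw [hsumR (fun s => ‖x s‖ ^ 2) fun s hs => by rw [hs, hx, norm_zero]; ring, ← key]
  field_simp

/-- **A dilation-invariant form is bounded by its largest eigenvalue**: if
`|∑_λ K(1,λ) χ(λ)| ≤ B` for every multiplicative character `χ` of the finite field `F`, then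
`|∑_{s,t} x_s conj(x_t) K(s,t)| ≤ B ∑_s |x_s|²` for all `x` with `x_0 = 0`.
[cite: KuniskyYu2022, Proposition 4.19] -/
theorem norm_dilationKernel_form_le (K : F → F → ℂ)
    (hK : ∀ i : F, i ≠ 0 → ∀ s t : F, K (i * s) (i * t) = K s t) (B : ℝ)
    (hΛ : ∀ χ : MulChar F ℂ, ‖∑ l : F, K 1 l * χ l‖ ≤ B) (x : F → ℂ) (hx : x 0 = 0) :
    ‖∑ s : F, ∑ t : F, x s * (starRingEnd ℂ) (x t) * K s t‖ ≤ B * ∑ s : F, ‖x s‖ ^ 2 := by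
  set n : ℕ := Fintype.card Fˣ with hn
  have hn0 : (n : ℂ) ≠ 0 := by exact_mod_cast Fintype.card_ne_zero
  have hnR : (0 : ℝ) < n := by exact_mod_cast Fintype.card_pos
  set Λ : MulChar F ℂ → ℂ := fun χ => ∑ l : F, K 1 l * χ l with hΛdef
  set X : MulChar F ℂ → ℂ := fun χ => ∑ s : F, x s * χ s with hXdef
  -- expand each weighted entry
  have hterm : ∀ s t : F, x s * (starRingEnd ℂ) (x t) * K s t =
      (n : ℂ)⁻¹ * ∑ χ : MulChar F ℂ, Λ χ * ((x s * χ s) * (starRingEnd ℂ) (x t * χ t)) := by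
    intro s t
    by_cases hs : s = 0
    · rw [hs, hx]; simp
    by_cases ht : t = 0
    · rw [ht, hx]; simp
    rw [dilationKernel_eq_sum_mulChar K hK hs ht, Finset.mul_sum, Finset.mul_sum, Finset.mul_sum]
    refine Finset.sum_congr rfl fun χ _ => ?_
    rw [map_mul]
    ring
  have hQ : ∑ s : F, ∑ t : F, x s * (starRingEnd ℂ) (x t) * K s t =
      (n : ℂ)⁻¹ * ∑ χ : MulChar F ℂ, Λ χ * (X χ * (starRingEnd ℂ) (X χ)) := by
    simp_rw [hterm]
    simp_rw [← Finset.mul_sum]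
    congr 1
    refine (Finset.sum_congr rfl fun s _ => Finset.sum_comm).trans ?_
    rw [Finset.sum_comm]
    refine Finset.sum_congr rfl fun χ _ => ?_
    rw [hXdef]
    simp only [map_sum]
    rw [Finset.sum_mul_sum, Finset.mul_sum]
    refine Finset.sum_congr rfl fun s _ => ?_
    rw [Finset.mul_sum]
  rw [hQ, norm_mul, norm_inv, Complex.norm_natCast]
  -- bound each eigenvalue by `B`
  have hbound : ‖∑ χ : MulChar F ℂ, Λ χ * (X χ * (starRingEnd ℂ) (X χ))‖ ≤
      ∑ χ : MulChar F ℂ, B * ‖X χ‖ ^ 2 := by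
    refine (norm_sum_le _ _).trans (Finset.sum_le_sum fun χ _ => ?_)
    rw [norm_mul, Complex.mul_conj, Complex.norm_real, Real.norm_eq_abs,
      abs_of_nonneg (Complex.normSq_nonneg _), Complex.normSq_eq_norm_sq]
    exact mul_le_mul_of_nonneg_right (hΛ χ) (by positivity)
  have hpl : ∑ χ : MulChar F ℂ, B * ‖X χ‖ ^ 2 = B * ((n : ℝ) * ∑ s : F, ‖x s‖ ^ 2) := by
    rw [← Finset.mul_sum, hXdef, sum_norm_sq_mulCharSum_eq x hx]
  rw [hpl] at hbound
  calc (n : ℝ)⁻¹ * ‖∑ χ : MulChar F ℂ, Λ χ * (X χ * (starRingEnd ℂ) (X χ))‖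
      ≤ (n : ℝ)⁻¹ * (B * ((n : ℝ) * ∑ s : F, ‖x s‖ ^ 2)) :=
        mul_le_mul_of_nonneg_left hbound (by positivity)
    _ = B * ∑ s : F, ‖x s‖ ^ 2 := by
        field_simp

end Dilation

end Literature.NumberTheory.GaussSums

end
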